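import Mathlib

set_option linter.dupNamespace false

/-!
# SoloBlindDepthSumTelescope — kernel certificate for the weight-one slot census (solo-blind s120)

In THEOREM 1(a) of `paper/descent6.md` (solo-blind residency, session 120) the weight-one part `D₁` of the
motivic coaction of the depth-sum family `G_{w,n}(z) = Σ_{u ∈ W_{w,n}} I^𝔪(0;u;1)` (letters `0` and `y = 1/z`)
is computed as follows: for a fixed quotient word `h = (h₁,…,h_L)` the cut at slot `p` contributes the
weight-one class `I^𝔩(h_p; b; h_{p+1}) = ℓ_b(h_{p+1}) − ℓ_b(h_p)` (`h₀ = 0`, `h_{L+1} = 1`), where for the block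
letter `b = 0`: `ℓ₀(0) = 0, ℓ₀(y) = log y, ℓ₀(1) = 0`, and for `b = y`: `ℓ_y(0) = log(−y), ℓ_y(y) = 0, ℓ_y(1) = log(1−y)`
(tangential regularisation `log 0 := 0`).  Hence the slot sums TELESCOPE:
* `b = 0` (slots `p = 1,…,L`, the word `h` starting with `y`): total `= −log y = log z`;
* `b = y` (slots `p = 0,…,L`): total `= log(1−y) − log(−y) = log(1−z)` (classes of roots of unity being torsion).
This file checks exactly this bookkeeping over an arbitrary additive commutative group of "logarithm symbols":
`adjSum_eq` (telescoping over adjacent pairs), `slotSum_block0`, `slotSum_blockY`.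
No Literature or Summit declaration is used; the statement `KZPeriodConjecture` is not touched.
-/

namespace Summit.KontsevichZagierPeriods.KontsevichZagierPeriods.Theorems

namespace DepthSumTelescope

variable {α : Type*} {G : Type*} [AddCommGroup G]

/-- Sum of `f y - f x` over the adjacent pairs `(x, y)` of a list. -/
def adjSum (f : α → G) : List α → G
  | a :: b :: t => (f b - f a) + adjSum f (b :: t)
  | _ => 0

/-- The empty list has no adjacent pairs. -/
@[simp] theorem adjSum_nil (f : α → G) : adjSum f ([] : List α) = 0 := rfl

/-- A singleton has no adjacent pairs. -/
@[simp] theorem adjSum_singleton (f : α → G) (a : α) : adjSum f [a] = 0 := rfl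

/-- Unfolding equation: the first adjacent pair `(a, b)` contributes `f b - f a`. -/
@[simp] theorem adjSum_cons_cons (f : α → G) (a b : α) (t : List α) :
    adjSum f (a :: b :: t) = (f b - f a) + adjSum f (b :: t) := rfl

/-- Telescoping: the adjacent-pair sum of `f y - f x` along `a :: t` is `f (last) - f a`. -/
theorem adjSum_eq (f : α → G) (a : α) (t : List α) :
    adjSum f (a :: t) = f ((a :: t).getLast (List.cons_ne_nil a t)) - f a := by
  induction t generalizing a with
  | nil => simp
  | cons b t ih =>
      rw [adjSum_cons_cons, ih b]
      have h : (a :: b :: t).getLast (List.cons_ne_nil a (b :: t))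
          = (b :: t).getLast (List.cons_ne_nil b t) := by
        simp [List.getLast_cons]
      rw [h]
      abel

/-- The three end/letter points `0`, `y = 1/z`, `1` of the iterated integrals `I(0; u; 1)`, `u ∈ {0,y}^w`. -/
inductive Pt
  | zero
  | y
  | one
  deriving DecidableEq

/-- Letters of a word: `true ↦ y`, `false ↦ 0`. -/
def toPt (b : Bool) : Pt := if b then Pt.y else Pt.zero

/-- The extended point sequence `0, h₁, …, h_L, 1` of a quotient word `h`. -/
def ext (h : List Bool) : List Pt := Pt.zero :: (h.map toPt ++ [Pt.one])

/-- Potential for the block letter `0`: `I(x; 0; x') = ℓ₀ x' - ℓ₀ x` with `ℓ₀(0) = 0`, `ℓ₀(y) = Ly := log y`,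
`ℓ₀(1) = log 1 = 0`. -/
def ell0 (Ly : G) : Pt → G
  | Pt.zero => 0
  | Pt.y => Ly
  | Pt.one => 0

/-- Potential for the block letter `y`: `I(x; y; x') = ℓ_y x' - ℓ_y x` with `ℓ_y(0) = Lmy := log(−y)`,
`ℓ_y(y) = log 0 := 0`, `ℓ_y(1) = L1y := log(1−y)`. -/
def ellY (Lmy L1y : G) : Pt → G
  | Pt.zero => Lmy
  | Pt.y => 0
  | Pt.one => L1y

/-- Block letter `y` (the case `m = 1`): the sum over ALL slots `p = 0,…,L` of the weight-one cuts
`I(h_p; y; h_{p+1})` along `0, h₁, …, h_L, 1` equals `log(1−y) − log(−y)`, for every word `h`. -/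
theorem slotSum_blockY (Lmy L1y : G) (h : List Bool) :
    adjSum (ellY Lmy L1y) (ext h) = L1y - Lmy := by
  unfold ext
  rw [adjSum_eq]
  have hl : (Pt.zero :: (h.map toPt ++ [Pt.one])).getLast (List.cons_ne_nil _ _) = Pt.one := by
    simp
  rw [hl]
  rfl

/-- Block letter `0` (the case `m = 0`): the sum over the slots `p = 1,…,L` (the slot `p = 0` is excluded because
the full word must begin with `y`) of the cuts `I(h_p; 0; h_{p+1})` along `h₁, …, h_L, 1`, for a word `h`
beginning with `y`, equals `−log y` (`= log z`). -/
theorem slotSum_block0 (Ly : G) (t : List Bool) :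
    adjSum (ell0 Ly) ((true :: t).map toPt ++ [Pt.one]) = -Ly := by
  have e : (true :: t).map toPt ++ [Pt.one] = Pt.y :: (t.map toPt ++ [Pt.one]) := by
    simp [toPt]
  rw [e, adjSum_eq]
  have hl : (Pt.y :: (t.map toPt ++ [Pt.one])).getLast (List.cons_ne_nil _ _) = Pt.one := by
    simp
  rw [hl]
  simp [ell0]

/-- If the quotient word begins with `0`, only the slot `p = 0` is admissible for the block `y`, and its cut
`I(0; y; 0)` vanishes (`ℓ_y 0 − ℓ_y 0 = 0`), so such words do not contribute. -/
theorem slot0_blockY_head0 (Lmy L1y : G) :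
    ellY Lmy L1y (toPt false) - ellY Lmy L1y Pt.zero = 0 := by
  simp [toPt]

/-- Sanity instance: `h = (y, 0, 0, y, y, 0)`; both census values. -/
example (Ly Lmy L1y : ℤ) :
    adjSum (ellY Lmy L1y) (ext [true, false, false, true, true, false]) = L1y - Lmy ∧
    adjSum (ell0 Ly) ([true, false, false, true, true, false].map toPt ++ [Pt.one]) = -Ly :=
  ⟨slotSum_blockY Lmy L1y _, slotSum_block0 Ly _⟩

end DepthSumTelescope

end Summit.KontsevichZagierPeriods.KontsevichZagierPeriods.Theorems
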